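import Summits.AtomisticToContinuum.Crystallization.Theorems.ThreeConeCertificateDefs
import Literature.MathematicalPhysics.StatisticalMechanics.LennardJonesClusters

/-!
# Crux `OnePercentCertificate` (stmt-AtomisticToContinuum-11958), line `perron-gauge-Sketch`:
# stub `stub_separated_of_siteEnergy_le` (hard core from bounded site energies)

For the finite-range part `gS = (V_LJ − fS)·1_{r < 5/2}` of the explicit split of
`ThreeConeCertificateDefs.lean`: if every particle of an injective configuration in `ℝ³` has
`gS`-site energy `≤ 1`, then all mutual distances are `≥ 1/8`.

This is the tree's removal-plus-packing template `LennardJonesMinimalDistance_holds`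
(Xue 1997 / Blanc–Lewin 2015, §2.2) re-run for `gS` with site-energy bound `1` (instead of `0`)
and threshold `1/8` (instead of `1/3`):

* envelopes: `fS ≤ 21997/10⁵` everywhere (the first Gaussian is `≤ 1`, the second and the
  Bernstein tail are `≥ 0`), hence `gS ρ ≥ ρ⁻¹²/12 − ρ⁻⁶/6 − 21997/10⁵` for `ρ < 5/2` and
  `gS ρ ≥ −54·ρ⁻⁶` for all `ρ > 0` (`(54 − 1/6)(2/5)⁶ > 21997/10⁵`; `gS = 0` beyond `5/2`);
* at a closest pair `(i₀, j₀)` with `r = |x_{i₀} − x_{j₀}| < 1/8`, the shell sum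
  `sum_inv_pow_six_le` (`Σ_{k ≠ i₀} |x_{i₀} − x_k|⁻⁶ ≤ 250 r⁻⁶`) gives
  `1 ≥ 𝓔^{i₀} ≥ r⁻¹²/12 − 54·250·r⁻⁶`, absurd since `r⁻⁶ > 8⁶ = 262144 > 12·13500`.
-/

noncomputable section

open scoped BigOperators
open Literature.MathematicalPhysics.StatisticalMechanics
open Summit.AtomisticToContinuum.Crystallization.Theorems.ThreeConeSplit

namespace Summit.AtomisticToContinuum.Crystallization.Theorems.PerronGauge

/-- The Bernstein tail `∫₀^{36/25} t² e^{−t r²} dt` is non-negative. [folklore] -/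
private theorem bernsteinTail_nonneg (r : ℝ) : 0 ≤ bernsteinTail (36 / 25) r := by
  unfold bernsteinTail
  exact intervalIntegral.integral_nonneg (by norm_num) fun t _ => by positivity

/-- The uniform envelope `fS ≤ A = 21997/10⁵` of the Bochner part. [folklore] -/
private theorem fS_le (r : ℝ) : fS r ≤ 21997 / 100000 := by
  unfold fS
  have h1 : Real.exp (-(169 / 100) * r ^ 2) ≤ 1 :=
    Real.exp_le_one_iff.2 (by nlinarith [sq_nonneg r])
  have h2 : 0 < Real.exp (-(81 / 100) * r ^ 2) := Real.exp_pos _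
  have h3 := bernsteinTail_nonneg r
  nlinarith

/-- Inside the range, `gS ρ ≥ ρ⁻¹²/12 − ρ⁻⁶/6 − 21997/10⁵`. [folklore] -/
private theorem lj_sub_le_gS {ρ : ℝ} (h : ρ < 5 / 2) :
    1 / 12 * ρ⁻¹ ^ 12 - 1 / 6 * ρ⁻¹ ^ 6 - 21997 / 100000 ≤ gS ρ := by
  unfold gS
  rw [if_pos h]
  unfold lennardJones
  have := fS_le ρ
  linarith

/-- The attractive envelope `gS ρ ≥ −54·ρ⁻⁶` for all `ρ > 0`. [folklore] -/
private theorem neg_mul_inv_pow_six_le_gS {ρ : ℝ} (hρ : 0 < ρ) : -54 * ρ⁻¹ ^ 6 ≤ gS ρ := by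
  rcases lt_or_ge ρ (5 / 2) with h | h
  · have hE := lj_sub_le_gS h
    have hinv : 2 / 5 < ρ⁻¹ := by
      rw [lt_inv_comm₀ (by norm_num) hρ]
      have : (2 / 5 : ℝ)⁻¹ = 5 / 2 := by norm_num
      linarith
    have hu : (64 / 15625 : ℝ) < ρ⁻¹ ^ 6 :=
      calc (64 / 15625 : ℝ) = (2 / 5) ^ 6 := by norm_num
        _ < ρ⁻¹ ^ 6 := pow_lt_pow_left₀ hinv (by norm_num) (by norm_num)
    have h12 : 0 ≤ ρ⁻¹ ^ 12 := by positivity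
    linarith
  · rw [gS_eq_zero h]
    have : 0 ≤ ρ⁻¹ ^ 6 := by positivity
    linarith

/-- **Hard core from bounded `gS`-site energies** (stub `stub_separated_of_siteEnergy_le` of line
`perron-gauge-Sketch`, crux stmt-AtomisticToContinuum-11958): if every particle of an injective
configuration in `ℝ³` has `gS`-site energy `≤ 1`, all mutual distances are `≥ 1/8`.  At a closest
pair `(i₀, j₀)`, `r = |x_{i₀} − x_{j₀}| < 1/8` would give, by the envelopes of `gS` and the shell
sum `sum_inv_pow_six_le`, `1 ≥ 𝓔^{i₀} ≥ r⁻¹²/12 − 13500·r⁻⁶`, absurd as `r⁻⁶ > 8⁶`.  The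
removal-plus-packing argument of Xue 1997 (qualitative content; constants not reproduced).
[cite: Xue1997, Main Theorem] -/
theorem stub_separated_of_siteEnergy_le :
    ∀ (N : ℕ) (x : Fin N → EuclideanSpace ℝ (Fin 3)), Function.Injective x →
      (∀ i, siteEnergy gS x i ≤ 1) → ∀ i j, i ≠ j → (1 / 8 : ℝ) ≤ dist (x i) (x j) := by
  intro N x hx hsite i j hij
  by_contra hlt
  rw [not_le] at hlt
  -- a closest pair `(i₀, j₀)`
  obtain ⟨p, hp, hmin⟩ := Finset.exists_min_image Finset.univ.offDiag
    (fun p : Fin N × Fin N => dist (x p.1) (x p.2)) ⟨(i, j), by simp [hij]⟩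
  obtain ⟨i₀, j₀⟩ := p
  have hij₀ : i₀ ≠ j₀ := by simpa using hp
  set r := dist (x i₀) (x j₀) with hr_def
  have hr : 0 < r := dist_pos.2 (hx.ne hij₀)
  have hsep : ∀ k l, k ≠ l → r ≤ dist (x k) (x l) := fun k l hkl => hmin (k, l) (by simp [hkl])
  have hr8 : r < 1 / 8 := (hsep i j hij).trans_lt hlt
  -- `r⁻⁶ > 8⁶`
  have hu : (262144 : ℝ) < r⁻¹ ^ 6 := by
    have h8 : 8 < r⁻¹ := by
      rw [lt_inv_comm₀ (by norm_num) hr]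
      have : (8 : ℝ)⁻¹ = 1 / 8 := by norm_num
      linarith
    calc (262144 : ℝ) = 8 ^ 6 := by norm_num
      _ < r⁻¹ ^ 6 := pow_lt_pow_left₀ h8 (by norm_num) (by norm_num)
  -- the shell sum
  have hS := sum_inv_pow_six_le x hr hsep i₀
  -- termwise lower bound on the site energy of `i₀`
  have hj : j₀ ∈ Finset.univ.erase i₀ := Finset.mem_erase.2 ⟨hij₀.symm, Finset.mem_univ _⟩
  have hterm : ∀ k ∈ Finset.univ.erase i₀,
      -54 * (dist (x i₀) (x k))⁻¹ ^ 6 + (if k = j₀ then 1 / 12 * r⁻¹ ^ 12 else 0)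
        ≤ gS (dist (x i₀) (x k)) := by
    intro k hk
    have hki : k ≠ i₀ := Finset.ne_of_mem_erase hk
    by_cases hkj : k = j₀
    · rw [if_pos hkj, hkj, ← hr_def]
      have hE := lj_sub_le_gS (show r < 5 / 2 by linarith)
      linarith
    · rw [if_neg hkj, add_zero]
      exact neg_mul_inv_pow_six_le_gS (dist_pos.2 (hx.ne hki.symm))
  have hsum := Finset.sum_le_sum hterm
  rw [Finset.sum_add_distrib, Finset.sum_ite_eq_of_mem' _ _ _ hj, ← Finset.mul_sum] at hsum
  have h1 : ∑ k ∈ Finset.univ.erase i₀, gS (dist (x i₀) (x k)) ≤ 1 := hsite i₀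
  -- conclusion: `1 ≥ r⁻¹²/12 − 13500 r⁻⁶` contradicts `r⁻⁶ > 262144`
  have h12 : r⁻¹ ^ 12 = r⁻¹ ^ 6 * r⁻¹ ^ 6 := by ring
  have hu' : 262144 * r⁻¹ ^ 6 < r⁻¹ ^ 6 * r⁻¹ ^ 6 := mul_lt_mul_of_pos_right hu (by linarith)
  rw [h12] at hsum
  linarith

end Summit.AtomisticToContinuum.Crystallization.Theorems.PerronGauge

end
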